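import Mathlib
import HarnessLib
import Summits.AnomalousDissipation.AnomalousDissipation.Theses.WazewskiBlock
import Summits.AnomalousDissipation.AnomalousDissipation.Theorems.WazewskiBlockUniformWorkFloorTrapLoadBearing
import Literature.Analysis.FluidPDE.GalerkinFlow
import Literature.Analysis.FluidPDE.PeriodicNSOrbitPersistsProofs
import Literature.Analysis.FunctionSpaces.TorusLinearisedFormTruncation
import Summits.AnomalousDissipation.AnomalousDissipation.Theorems.WazewskiBlockUniformWorkFloorTrapStubPerturbedBorderedSolve
import Summits.AnomalousDissipation.AnomalousDissipation.Theorems.WazewskiBlockUniformWorkFloorTrapStubCompactTruncationNorm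
import Summits.AnomalousDissipation.AnomalousDissipation.Theorems.WazewskiBlockUniformWorkFloorTrapStubSpatialTruncation
import Summits.AnomalousDissipation.AnomalousDissipation.Theorems.WazewskiBlockUniformWorkFloorTrapStubSynthSlices
import Summits.AnomalousDissipation.AnomalousDissipation.Theorems.WazewskiBlockUniformWorkFloorTrapStubCoeffCurveODE

/-!
# Line `work-lipschitz-cycles` — crux `WazewskiBlock.UniformWorkFloorTrap` (stmt-AnomalousDissipation-10353)

Crux-plan skeleton (planner-cruxplan-stmt-AnomalousDissipation-10353-work-lipschitz-cycle-0, 2026-08-16) for the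
crux idea card `Cruxes/UniformWorkFloorTrap/Ideas/work-lipschitz-cycles.md` (ideator 1, round 1), sharpened by the
triage panel (TRIAGE-r1-1 fail (iv) · r1-2 PASS · r1-3 fail (iv); all three: "persistence lever TRUE in print, drop the
three-scalar floor, the line is exactly {Galerkin persistence of a nondegenerate cycle at fixed ν (provable, L) ;
C⁺_cyc (conjecture-class core)}") and by the lead's dead-line census `Lines/SketchDead.md` §"What a line would need"
("the only honest shapes are CONDITIONAL BRIDGES: (a) C⁺_cyc → crux with C⁺ an N-free PDE statement … plus a
Galerkin-persistence stub (Poincaré-map IFT)").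

THE LINE (a conditional bridge, N removed by a theorem). The crux asks, for ONE mean-zero trig-polynomial force `f` and
constants `E, ε₀ > 0`, at every small viscosity `ν` and EVERY Galerkin order `N ≥ N₀(ν)`, for a global Galerkin
trajectory trapped for all `t ≥ 0` in `B = {kineticEnergy ≤ E} ∩ {(f, ·) ≥ ε₀}`; by the landed equivalence
`uniformWorkFloorTrap_iff_orbit` (p107806) this is: a Galerkin mode `a` of order `N` whose `Torus.galerkinFlow ν f N`
orbit stays in `B`. The witnesses of this line are GALERKIN SHADOWS OF ONE NONDEGENERATE LOUD BOUNDED CYCLE OF `NS_ν`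
PER VISCOSITY:

  crux ⇐ (orbit form, p107806)
       ⇐ for every `0 < ν ≤ ν₀`: a classical `τ`-periodic solution `u` of `NS_ν(f)` in the mean-zero leaf, NONDEGENERATE
         (Floquet multiplier `1` simple — clauses (i)/(ii) of the tree's PROVED `PeriodicNSOrbitPersists`, verbatim),
         with the pointwise margins `kineticEnergy (u t) ≤ E`, `(f, u t) ≥ 2ε₁`            … `stub_loudNondegenerateCycles`
       + at FIXED `ν`: such a cycle persists as a periodic orbit of `galerkinFlow ν f N` for all `N ≥ N₀(ν)`, uniformly
         `L²`-close in time after the period rescaling                                      … `stub_galerkinCyclePersistence`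
       + proved here: `L²`-closeness `≤ δ(f, ε₁)` transports the margins into `B(2E + 1, ε₁)`   … `margins_of_sq_dist_le`.

Registered stubs (def-free signatures over tree declarations; `sorry` only inside `stub_*`):
* `stub_loudNondegenerateCycles` — CORE, conjecture-class (HARDEST): the card's `C⁺_cyc` in its weakest form feeding the
  composition (NONDEGENERATE instead of hyperbolic; mean-zero leaf; non-strict `L²`-level margins). It is the ν-UNIFORM
  loud bounded cycle family for one fixed 3-D force — supported by UPO numerics only (VanVeenKidaKawahara2006
  arXiv:1804.00547 §4; LucasKerswell2017 arXiv:1611.04829 §3) and, as the panel objects (r1-1/r1-3, protocol (iv)), it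
  already proves the summit through `CoherentStates.closes` (0218 `CoherentThesis` ⇐ period energy balance) with the
  nondegeneracy discarded. Kernel-checked bracket it must respect: it implies the crux (this file), hence
  `Correlation.CorrelationPersistence` (p110281); its ν-dependent reading is trivial, a ν-uniform `N₀` impossible (p107806).
* `stub_galerkinCyclePersistence` — L, PROVABLE NOW: the Galerkin twin of Henry's perturbation theorem
  (`Literature.Analysis.FluidPDE.PeriodicNSOrbitPersists`, DISCHARGED in tree by `PeriodicNSOrbitPersists_holds` via the
  space–time Fourier lattice `G(x, ω) = ω Dₛx + L₀x + B(x,x) = y_f`, bordered inverse-function argument, compactness of the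
  linearised convection): replace the force perturbation by the spectral truncation `B ↦ P_N B(P_N·, P_N·)` on
  `W_N = P_N W`; consistency `‖P_N B(P_N x₀, P_N x₀) − B(x₀, x₀)‖ → 0` (rapid decay of `x₀`), stability of the bordered
  linearisation (`J` commutes with `P_N`, `‖P_N K P_N − K‖ → 0` for compact `K`); the lattice solution on `W_N` is a
  smooth periodic solution of the Galerkin ODE of order `N`, i.e. (uniqueness, `IsGalerkinODESolution.eqOn`) a periodic
  orbit of `Torus.galerkinFlow ν f N`. Print: Henry 1981 Thm 8.3.2 / Iooss 1972 §2–3 (nondegeneracy = regular point of the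
  bordered period map); Brezzi–Rappaz–Raviart 1980 Part I (doi:10.1007/bf01395985: projection approximation of branches of
  NONSINGULAR solutions of `u + T G(u) = 0`, `T` compact — here the bordered space–time problem); Titi 1991 (C. R. Acad.
  Sci. 312, 41–43: a criterion for the Galerkin approximation of time-periodic NS solutions, as reported in Stuart, Acta
  Numerica 1994 §5.3, READ); the space–time Fourier × Galerkin framework of van den Berg–Breden–Lessard–van Veen 2021
  (arXiv:1902.00384). NOT the statement of Alouges–Debussche 1993 (doi:10.1007/bf01385746), which is the TIME-discretisation
  analogue (invariant closed curves near a HYPERBOLIC orbit; zbMATH review read) — hyperbolicity is not needed here.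

No `Disproof.lean` exists for this crux on this hub (payload `disproof_path` absent; `ledger crux ls`: none) — nothing
to honour beyond the landed Negative-type facts: `not_uniformWorkFloorTrap_fixedResolution` (our `N₀` depends on `ν`:
honoured, `N₀ = N₀(ν, δ)` comes from the persistence stub), `not_trapped_of_stressThreshold` p106251 (`E ≥ E_c(f) − O(ν)`:
a constraint on the core's witnesses, automatically met by any genuine loud cycle), `PlanarGalerkinNoTrap` 10356 /
AlexakisDoering (the core's force must be genuinely 3-D: `f` is existential).
RESHAPE (lead a1, 2026-08-16): `stub_galerkinCyclePersistence` (L, ≈ 2 kLoC) is split at the skeleton level into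
five registered sub-stubs and PROVED here from them by glue adapted from `TimePeriodicLattice.persists_main`:
* `stub_perturbedBorderedSolve` — abstract (real Banach space): the bordered local solve of
  `TimePeriodicLattice.bordered_local_solve` survives replacing `B(x,x)` by `P_n B(x,x)` for contractions `P_n` with
  `‖P_n K − K‖ → 0` and `P_n B(x₀,x₀) → B(x₀,x₀)` (Brezzi–Rappaz–Raviart 1980, Part I, Thm. 3; quantitative inverse
  function theorem `ApproximatesLinearOn.surjOn_closedBall_of_nonlinearRightInverse` around the FIXED bordered
  isomorphism of `Literature.Analysis.Calculus.bordered_bijective`);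
* `stub_compactTruncationNorm` — abstract: strongly convergent contractions converge in operator norm after a compact
  operator (`‖P_n K − K‖ → 0`);
* `stub_spatialTruncation` — the spatial truncation multipliers `P_N = 𝟙{|k|² ≤ N²}` on `W` (`exists_diag`), contractions,
  strongly convergent to the identity (tails of `ℓ²` sums);
* `stub_coeffCurveODE` — the time-Fourier dictionary: a rapidly decaying transversal conjugate-symmetric lattice family
  supported in `|k|² ≤ N²` solving the TRUNCATED projected lattice equation has time-summed coefficient curve
  `t ↦ (∑ₙ e_n(ωt) c(n,k))_{|k|² ≤ N²}` solving the Galerkin ODE `α' = galerkinRHS (freqBall N) ν f̂ α`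
  (Cauchy product of the time series = `convectionCoeff`; `lerayCoeff = leraySym`);
* `stub_synthSlices` — the slices of the real synthesis of such a family are Galerkin modes of order `N` with exactly
  those coefficients (`mFourierCoeff_timeSlice_fourierSynth`, `realSynth_spec'`, `div_realSynth_eq_zero`).
Glue (proved below, `stub_galerkinCyclePersistence`): state space, orbit, multipliers, bilinear map, compact
linearisation, kernel/range conditions VERBATIM as in `persists_main`; then truncations, perturbed solve, coordinates of
the truncated equation, support in the ball (`N ≥ m`, symbol bounded below), parabolic regularity
(`moments_of_lattice_ineq`), the dictionary stubs, uniqueness for the Galerkin ODE (`galerkinCoeffFlow_eq`) and the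
slice bound `slice_h1_le`.
-/

noncomputable section

-- `Summit.<Summit>.<Problem>`: single-conjunct summit, the duplicate namespace is mandated (CONVENTIONS §2).
set_option linter.dupNamespace false

namespace Summit.AnomalousDissipation.AnomalousDissipation.Cruxes.UniformWorkFloorTrap.WorkLipschitzCycles

open scoped InnerProductSpace Topology ENNReal NNReal ComplexConjugate
open MeasureTheory Filter Set Function UnitAddTorus
open Literature.Analysis.FunctionSpaces Literature.Analysis.FunctionSpaces.Torus
open Literature.Analysis.FunctionSpaces.EuclideanSpace
open Literature.Analysis.FluidPDE Literature.Analysis.FluidPDE.ScalarFourier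
open Literature.Analysis.FluidPDE.TimePeriodicLattice
open Summit.AnomalousDissipation.AnomalousDissipation.Theses.WazewskiBlock (UniformWorkFloorTrap)
open Summit.AnomalousDissipation.AnomalousDissipation.Theorems.UniformWorkFloorTrap
  (uniformWorkFloorTrap_iff_orbit)

/-- The flat three-torus. -/
local notation "𝕋³" => UnitAddTorus (Fin 3)
/-- Velocity values on `T³`. -/
local notation "E³" => EuclideanSpace ℝ (Fin 3)
/-- Complexified velocity values (linearised problem). -/
local notation "ℂ³" => EuclideanSpace ℂ (Fin 3)

-- NOTATION START (verbatim from `TimePeriodicNSLattice*` / `PeriodicNSOrbitPersistsProofs`)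
/-- Local notation: the parabolic weight `Λ(n, k) = |n| + |k|²`. -/
local notation:max "Λ" m:max => (|((Prod.fst m : ℤ) : ℝ)| + freqNormSq (Prod.snd m))

/-- Local notation: the convective symbol on `ℤ × ℤ³`. -/
local notation:max "𝐍[" a ", " b "]" m:max =>
  (WithLp.toLp 2 (fun p : Fin 3 => ∑ j : Fin 3, ∑' m' : ℤ × (Fin 3 → ℤ),
    a m' j * (dsym j (Prod.snd m - Prod.snd m') * b (m - m') p)) : EuclideanSpace ℂ (Fin 3))

/-- Local notation: division by the weight. -/
local notation:max "𝐜" x:max => (fun mm : ℤ × (Fin 3 → ℤ) =>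
  ((((|((Prod.fst mm : ℤ) : ℝ)| + freqNormSq (Prod.snd mm))⁻¹ : ℝ) : ℂ) • x mm))

/-- Local notation: multiplication by the weight. -/
local notation:max "𝐬" x:max => (fun mm : ℤ × (Fin 3 → ℤ) =>
  ((((|((Prod.fst mm : ℤ) : ℝ)| + freqNormSq (Prod.snd mm)) : ℝ) : ℂ) • x mm))

/-- Local notation: the family of coefficients of `x ∈ W ⊂ ℓ²`. -/
local notation:max "𝐰" x:max =>
  (((x : lp (fun _ : ℤ × (Fin 3 → ℤ) => EuclideanSpace ℂ (Fin 3)) 2)) : ℤ × (Fin 3 → ℤ) → EuclideanSpace ℂ (Fin 3))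

/-- Local notation: the extension `K ↦ c (K₀, tail K)` of a lattice family to `ℤ⁴`. -/
local notation:max "𝐄" c:max => (fun K : Fin 4 → ℤ => c ((K 0, Fin.tail K) : ℤ × (Fin 3 → ℤ)))

/-- Local notation: the lattice family of the orbit `u` with period `τ`. -/
local notation:max "𝐨[" τ ", " u "]" => (fun mm : ℤ × (Fin 3 → ℤ) =>
  mFourierCoeff (EuclideanSpace.complexify ∘ fun y : UnitAddTorus (Fin 4) => Torus.timeRoll τ u y - ∫ x, u 0 x)
    (Fin.cons (Prod.fst mm) (Prod.snd mm) : Fin 4 → ℤ))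

/-- Local notation: the force family `y_F(n,k) = [k ≠ 0][n = 0] 𝓕(complexify ∘ F)(k)`. -/
local notation:max "𝐲" F:max => (fun mm : ℤ × (Fin 3 → ℤ) =>
  (ite (Prod.snd mm = 0) (0 : EuclideanSpace ℂ (Fin 3))
    (ite (Prod.fst mm = 0) (mFourierCoeff (EuclideanSpace.complexify ∘ F) (Prod.snd mm)) 0)))

/-- Local notation: the time multiplier `dₛ(n,k) = 2πi n / Λ(n,k)`. -/
local notation "dS" => (fun mm : ℤ × (Fin 3 → ℤ) =>
  (2 * Real.pi * Complex.I * ((Prod.fst mm : ℤ) : ℂ)) * ((((|((Prod.fst mm : ℤ) : ℝ)| + freqNormSq (Prod.snd mm)) : ℝ) : ℂ))⁻¹)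

/-- Local notation: the Stokes–drift multiplier `(4π²ν|k|² + 2πi m₀·k) / Λ(n,k)`. -/
local notation "dL[" ν ", " m₀ "]" => (fun mm : ℤ × (Fin 3 → ℤ) =>
  (((4 * Real.pi ^ 2 * ν * freqNormSq (Prod.snd mm) : ℝ) : ℂ) +
      2 * Real.pi * Complex.I * (∑ jj : Fin 3, ((m₀ jj : ℝ) : ℂ) * (((Prod.snd mm) jj : ℤ) : ℂ))) *
    ((((|((Prod.fst mm : ℤ) : ℝ)| + freqNormSq (Prod.snd mm)) : ℝ) : ℂ))⁻¹)

/-- Local notation: the symbol `σ_om(n,k) = 2πiomn + 4π²ν|k|² + 2πi m₀·k`. -/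
local notation "σ[" om ", " ν ", " m₀ "]" => (fun mm : ℤ × (Fin 3 → ℤ) =>
  2 * Real.pi * Complex.I * ((om : ℝ) : ℂ) * ((Prod.fst mm : ℤ) : ℂ) +
    (((4 * Real.pi ^ 2 * ν * freqNormSq (Prod.snd mm) : ℝ)) : ℂ) +
    2 * Real.pi * Complex.I * (∑ jj : Fin 3, ((m₀ jj : ℝ) : ℂ) * (((Prod.snd mm) jj : ℤ) : ℂ)))
-- NOTATION END

/-! ## The stubs -/

/-- **CORE STUB (hardest; conjecture-class).** *ν-uniformly loud, bounded, nondegenerate cycles of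
`NS_ν` for one steady 3-D trig-polynomial force.* There are a mean-zero Galerkin-mode force `f` of
order `m`, constants `E`, `ε₁ > 0`, `ν₀ > 0` such that for every `0 < ν ≤ ν₀` the Navier–Stokes
equations `NS_ν(f)` on `T³` carry a classical solution `(u, p)` on `ℝ × T³`, `τ`-periodic in time
(`τ = τ(ν) > 0`), in the mean-zero leaf, NONDEGENERATE — the Floquet multiplier `1` of the
linearisation along `u` is simple: (i) every jointly smooth divergence-free mean-zero `τ`-periodic
solution `(w, q)` of `∂ₜw = νΔw − (u·∇)w − (w·∇)u − ∇q` is a complex multiple of `∂ₜu`, (ii) the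
problem with the extra source `∂ₜu` has no such solution (verbatim the hypotheses of
`Literature.Analysis.FluidPDE.PeriodicNSOrbitPersists`) — and LOUD AND BOUNDED POINTWISE with
ν-free constants: `kineticEnergy (u t) ≤ E` and `(f, u t) ≥ 2ε₁` for all `t`. (Hyperbolic cycles
are nondegenerate; intended witnesses: the period-5 UPO of Kida's high-symmetric flow continued in
`ν` with ν-independent dissipation `ē = ε̄ = 0.107`, VanVeenKidaKawahara2006 §4; genuinely 3-D by
force choice, as `PlanarGalerkinNoTrap` demands.) -/
theorem stub_loudNondegenerateCycles :
    ∃ (m : ℕ) (f : 𝕋³ → E³), IsGalerkinMode m f ∧ HasZeroMean f ∧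
      ∃ (E ε₁ ν₀ : ℝ), 0 < ε₁ ∧ 0 < ν₀ ∧ ∀ ν : ℝ, 0 < ν → ν ≤ ν₀ →
        ∃ (τ : ℝ) (u : ℝ → 𝕋³ → E³) (p : ℝ → 𝕋³ → ℝ), 0 < τ ∧
          Torus.IsClassicalNSSolutionOn Set.univ ν (fun _ => f) u p ∧ Function.Periodic u τ ∧
          (∀ t, HasZeroMean (u t)) ∧
          (∀ (w : ℝ → 𝕋³ → ℂ³) (q : ℝ → 𝕋³ → ℂ),
              Torus.IsSmoothSpaceTimeOn Set.univ w → Torus.IsSmoothSpaceTimeOn Set.univ q →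
              (∀ t, Torus.IsDivFreeC (w t)) → (∀ t, HasZeroMean (w t)) → Function.Periodic w τ →
              (∀ t x, Torus.timeDerivWithin Set.univ w t x =
                Torus.linearizedNSOperator ν (u t) (w t) (q t) x) →
              ∃ z : ℂ, ∀ t x, w t x =
                z • Torus.realToComplex (Torus.timeDerivWithin Set.univ u t x)) ∧
          (∀ (w : ℝ → 𝕋³ → ℂ³) (q : ℝ → 𝕋³ → ℂ),
              Torus.IsSmoothSpaceTimeOn Set.univ w → Torus.IsSmoothSpaceTimeOn Set.univ q →
              (∀ t, Torus.IsDivFreeC (w t)) → (∀ t, HasZeroMean (w t)) → Function.Periodic w τ →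
              ∃ t x, Torus.timeDerivWithin Set.univ w t x ≠
                Torus.linearizedNSOperator ν (u t) (w t) (q t) x +
                  Torus.realToComplex (Torus.timeDerivWithin Set.univ u t x)) ∧
          (∀ t, kineticEnergy (u t) ≤ E ∧ 2 * ε₁ ≤ ∫ x, ⟪f x, u t x⟫_ℝ) := by
  sorry

/-! ## The registered sub-stubs of `stub_galerkinCyclePersistence` (reshape, lead a1) -/

/-- **S1 · Perturbed bordered local solve** (abstract; Brezzi–Rappaz–Raviart 1980, Part I, Thm. 3, for the bordered
time-periodic map of `TimePeriodicLattice.bordered_local_solve`). In the setting of `bordered_local_solve`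
(`G(x, ω) = ω ∂ₛx + L₀x + B(x,x)`, `J = ω₀∂ₛ + L₀` a linear homeomorphism, `K = B(x₀,·) + B(·,x₀)` compact,
`ker(J + K) ⊆ ℝg`, `∂ₛx₀ ∉ range(J + K)`), let `P_n` be contractions with `‖P_n K − K‖ → 0` and
`P_n B(x₀,x₀) → B(x₀,x₀)`. Then for every `δ > 0` and all large `n` the TRUNCATED equation
`ω ∂ₛx + L₀x + P_n B(x,x) = G(x₀, ω₀)` has a solution with `‖x − x₀‖ < δ`, `|ω − ω₀| < δ`.
(Proof route: the bordered isomorphism `Ψ'(h, μ) = ((J + K)h + μ ∂ₛx₀, φ h)` of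
`Literature.Analysis.Calculus.bordered_bijective` is FIXED; the truncated bordered map
`Ψ_n(x, ω) = (ω ∂ₛx + L₀x + P_n B(x,x), φ(x − x₀))` approximates it on a small ball with constant
`2ε‖∂ₛ‖ + ‖P_n K − K‖ + 2‖B‖ε < ‖Ψ'⁻¹‖⁻¹/2`, so `ApproximatesLinearOn.surjOn_closedBall_of_nonlinearRightInverse`
covers `(G(x₀,ω₀), 0)`, which is `‖(P_n − 1)B(x₀,x₀)‖`-close to `Ψ_n(x₀, ω₀)`.) -/
theorem stub_perturbedBorderedSolve {E : Type} [NormedAddCommGroup E] [NormedSpace ℝ E] [CompleteSpace E]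
    (Ds L₀ : E →L[ℝ] E) {B : E → E → E}
    (hBb : IsBoundedBilinearMap ℝ (fun p : E × E => B p.1 p.2)) (x₀ : E) (ω₀ : ℝ)
    (J : E ≃L[ℝ] E) (hJ : ∀ h, J h = ω₀ • Ds h + L₀ h)
    (K : E →L[ℝ] E) (hK : ∀ h, K h = B x₀ h + B h x₀) (hKc : IsCompactOperator K)
    (g : E) (hker : ∀ h, J h + K h = 0 → ∃ z : ℝ, h = z • g) (hrange : ∀ h, J h + K h ≠ Ds x₀)
    (P : ℕ → E →L[ℝ] E) (hP : ∀ n, ‖P n‖ ≤ 1)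
    (hPK : Tendsto (fun n => ‖(P n).comp K - K‖) atTop (𝓝 0))
    (hPB : Tendsto (fun n => P n (B x₀ x₀)) atTop (𝓝 (B x₀ x₀)))
    {δ : ℝ} (hδ : 0 < δ) :
    ∃ N₀ : ℕ, ∀ n, N₀ ≤ n → ∃ (x : E) (ω : ℝ),
      ω • Ds x + L₀ x + P n (B x x) = ω₀ • Ds x₀ + L₀ x₀ + B x₀ x₀ ∧ ‖x - x₀‖ < δ ∧ |ω - ω₀| < δ :=
  -- LANDED p116617 (stub-worker, wave 1)
  Summit.AnomalousDissipation.AnomalousDissipation.Theorems.UniformWorkFloorTrap.WorkLipschitzCycles.stub_perturbedBorderedSolve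
    Ds L₀ hBb x₀ ω₀ J hJ K hK hKc g hker hrange P hP hPK hPB hδ

/-- **S2 · Compact operators upgrade strong to norm convergence** (abstract, folklore; e.g. Brezzi–Rappaz–Raviart
1980, Part I, (3.7)): if `K` is compact and the contractions `P_n` converge strongly to the identity, then
`‖P_n K − K‖ → 0` (finite `ε`-net of the totally bounded set `K(ball)`, equicontinuity `‖P_n‖ ≤ 1`). -/
theorem stub_compactTruncationNorm {E : Type} [NormedAddCommGroup E] [NormedSpace ℝ E]
    (K : E →L[ℝ] E) (hKc : IsCompactOperator K) (P : ℕ → E →L[ℝ] E) (hP : ∀ n, ‖P n‖ ≤ 1)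
    (hPs : ∀ y, Tendsto (fun n => P n y) atTop (𝓝 y)) :
    Tendsto (fun n => ‖(P n).comp K - K‖) atTop (𝓝 0) :=
  -- LANDED p116359 (stub-worker, wave 1)
  Summit.AnomalousDissipation.AnomalousDissipation.Theorems.UniformWorkFloorTrap.WorkLipschitzCycles.stub_compactTruncationNorm K hKc P hP hPs

/-- **S3 · The spatial truncations on `W`** (folklore): the Fourier multipliers `P_N = 𝟙{|k|² ≤ N²}` act on the
state space `W` of `TimePeriodicLattice.exists_space` (`exists_diag` with a real even symbol of norm `≤ 1`), are
contractions, and converge strongly to the identity (`‖P_N x − x‖² = ∑_{|k|² > N²} ‖x(n,k)‖² → 0`, the tail of a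
summable family: every finite set of modes lies in `{|k|² ≤ N²}` for large `N`). -/
theorem stub_spatialTruncation
    {W : Submodule ℝ (lp (fun _ : ℤ × (Fin 3 → ℤ) => EuclideanSpace ℂ (Fin 3)) 2)}
    (hW : ∀ x : lp (fun _ : ℤ × (Fin 3 → ℤ) => EuclideanSpace ℂ (Fin 3)) 2, x ∈ W ↔
      (∀ n : ℤ, (x : ℤ × (Fin 3 → ℤ) → EuclideanSpace ℂ (Fin 3)) (n, 0) = 0) ∧
      (∀ mm : ℤ × (Fin 3 → ℤ), (∑ jj : Fin 3, ((mm.2 jj : ℤ) : ℂ) *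
        ((x : ℤ × (Fin 3 → ℤ) → EuclideanSpace ℂ (Fin 3)) mm) jj) = 0) ∧
      (∀ mm : ℤ × (Fin 3 → ℤ), (x : ℤ × (Fin 3 → ℤ) → EuclideanSpace ℂ (Fin 3)) (-mm) =
        conjVec ((x : ℤ × (Fin 3 → ℤ) → EuclideanSpace ℂ (Fin 3)) mm))) :
    ∃ P : ℕ → W →L[ℝ] W,
      (∀ (N : ℕ) (x : W) (m : ℤ × (Fin 3 → ℤ)),
        (((P N x : W) : lp (fun _ : ℤ × (Fin 3 → ℤ) => EuclideanSpace ℂ (Fin 3)) 2) :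
            ℤ × (Fin 3 → ℤ) → EuclideanSpace ℂ (Fin 3)) m =
          if freqNormSq m.2 ≤ (N : ℝ) ^ 2 then
            (((x : lp (fun _ : ℤ × (Fin 3 → ℤ) => EuclideanSpace ℂ (Fin 3)) 2) :
              ℤ × (Fin 3 → ℤ) → EuclideanSpace ℂ (Fin 3)) m) else 0) ∧
      (∀ N, ‖P N‖ ≤ 1) ∧ (∀ x : W, Tendsto (fun N => P N x) atTop (𝓝 x)) :=
  -- LANDED p116420 (stub-worker, wave 1)
  Summit.AnomalousDissipation.AnomalousDissipation.Theorems.UniformWorkFloorTrap.WorkLipschitzCycles.stub_spatialTruncation hW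

/-- **S5 · Slices of the real synthesis of a truncated lattice family** (folklore dictionary): for a transversal,
conjugate-symmetric lattice family `c` on `ℤ × ℤ³` vanishing on the zero spatial modes and off the ball
`|k|² ≤ N²`, with rapidly decaying extension to `ℤ⁴`, every time slice `x ↦ Re F_{𝐄c}(ωt, x)` of its real
synthesis is a Galerkin mode of order `N` (smooth: `realSynth_spec'`; divergence free: `div_realSynth_eq_zero`;
band-limited) whose `k`-th Fourier coefficient is the time sum `∑ₙ eₙ(ωt) c(n,k)`
(`mFourierCoeff_timeSlice_fourierSynth`). -/
theorem stub_synthSlices (c : ℤ × (Fin 3 → ℤ) → ℂ³) (N : ℕ) (ω : ℝ)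
    (hc0 : ∀ n : ℤ, c (n, 0) = 0)
    (hct : ∀ m : ℤ × (Fin 3 → ℤ), (∑ jj : Fin 3, ((m.2 jj : ℤ) : ℂ) * (c m) jj) = 0)
    (hcs : ∀ m, c (-m) = conjVec (c m))
    (hcN : ∀ m : ℤ × (Fin 3 → ℤ), (N : ℝ) ^ 2 < freqNormSq m.2 → c m = 0)
    (hcr : RapidDecay (fun K : Fin 4 → ℤ => c (K 0, Fin.tail K))) :
    (∀ t : ℝ, IsGalerkinMode N (fun x : 𝕋³ => EuclideanSpace.realPart
        (fourierSynth (fun K : Fin 4 → ℤ => c (K 0, Fin.tail K)) (Fin.cons (((ω * t : ℝ)) : UnitAddCircle) x)))) ∧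
    (∀ (t : ℝ) (k : Fin 3 → ℤ), mFourierCoeff (EuclideanSpace.complexify ∘ fun x : 𝕋³ => EuclideanSpace.realPart
        (fourierSynth (fun K : Fin 4 → ℤ => c (K 0, Fin.tail K)) (Fin.cons (((ω * t : ℝ)) : UnitAddCircle) x))) k =
        ∑' n : ℤ, (fourier n (((ω * t : ℝ)) : UnitAddCircle) : ℂ) • c (n, k)) :=
  -- LANDED p116511 (stub-worker, wave 1)
  Summit.AnomalousDissipation.AnomalousDissipation.Theorems.UniformWorkFloorTrap.WorkLipschitzCycles.stub_synthSlices c N ω hc0 hct hcs hcN hcr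

/-- **S4 · The time-Fourier dictionary: a truncated lattice solution solves the Galerkin ODE** (folklore; the
Galerkin twin of `TimePeriodicLattice.realize_nonlinear`). Let `c` be a transversal conjugate-symmetric lattice
family vanishing on the zero spatial modes and off `|k|² ≤ N²`, with rapidly decaying extension, solving the
TRUNCATED projected lattice equation `(2πiωn + 4π²ν|k|²) c(n,k) + Π_k N(c,c)(n,k) = [n = 0] f̂(k)` on
`0 < |k|² ≤ N²` for a mean-zero Galerkin-mode force `f` of order `N` (no drift: mean-zero leaf). Then the
time-summed coefficient curve `α(t) = (∑ₙ eₙ(ωt) c(n,k))_{|k|² ≤ N²}` is continuous and solves the Galerkin ODE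
`α' = galerkinRHS (freqBall N) ν f̂ α` of `Literature.Analysis.FluidPDE.GalerkinFlow` at every time (termwise
differentiation by rapid decay; the time sum of the lattice convolution `N(c,c)` is the Cauchy product
`convectionCoeff (freqBall N) α α` — `mFourierCoeff_convect_realTrigPoly` read on the lattice;
`Torus.lerayCoeff = leraySym`, `leraySym_k f̂(k) = f̂(k)` for divergence-free `f`, and both sides vanish at
`k = 0` by transversality and `∫ f = 0`). -/
theorem stub_coeffCurveODE (c : ℤ × (Fin 3 → ℤ) → ℂ³) (N : ℕ) (ω ν : ℝ) (f : 𝕋³ → E³)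
    (hω : 0 < ω) (hf : IsGalerkinMode N f) (hf0 : HasZeroMean f)
    (hc0 : ∀ n : ℤ, c (n, 0) = 0)
    (hct : ∀ m : ℤ × (Fin 3 → ℤ), (∑ jj : Fin 3, ((m.2 jj : ℤ) : ℂ) * (c m) jj) = 0)
    (hcs : ∀ m, c (-m) = conjVec (c m))
    (hcN : ∀ m : ℤ × (Fin 3 → ℤ), (N : ℝ) ^ 2 < freqNormSq m.2 → c m = 0)
    (hcr : RapidDecay (fun K : Fin 4 → ℤ => c (K 0, Fin.tail K)))
    (heq : ∀ m : ℤ × (Fin 3 → ℤ), m.2 ≠ 0 → freqNormSq m.2 ≤ (N : ℝ) ^ 2 →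
      (2 * Real.pi * Complex.I * (ω : ℂ) * (m.1 : ℂ) + ((4 * Real.pi ^ 2 * ν * freqNormSq m.2 : ℝ) : ℂ)) • c m +
        Torus.lerayCoeff m.2 (WithLp.toLp 2 (fun p : Fin 3 => ∑ j : Fin 3, ∑' m' : ℤ × (Fin 3 → ℤ),
          c m' j * (dsym j (m.2 - m'.2) * c (m - m') p)) : ℂ³) =
        if m.1 = 0 then mFourierCoeff (EuclideanSpace.complexify ∘ f) m.2 else 0) :
    (Continuous (fun t : ℝ => fun k : ↥(freqBall N : Finset (Fin 3 → ℤ)) =>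
        ∑' n : ℤ, (fourier n (((ω * t : ℝ)) : UnitAddCircle) : ℂ) • c (n, (k : Fin 3 → ℤ)))) ∧
    (∀ t : ℝ, HasDerivAt (fun s : ℝ => fun k : ↥(freqBall N : Finset (Fin 3 → ℤ)) =>
        ∑' n : ℤ, (fourier n (((ω * s : ℝ)) : UnitAddCircle) : ℂ) • c (n, (k : Fin 3 → ℤ)))
      (galerkinRHS (freqBall N) ν (fourierRestrict (freqBall N) f)
        (fun k : ↥(freqBall N : Finset (Fin 3 → ℤ)) =>
          ∑' n : ℤ, (fourier n (((ω * t : ℝ)) : UnitAddCircle) : ℂ) • c (n, (k : Fin 3 → ℤ)))) t) :=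
  -- LANDED/PENDING (lead a1): Theorems/WazewskiBlockUniformWorkFloorTrapStubCoeffCurveODE.lean
  Summit.AnomalousDissipation.AnomalousDissipation.Theorems.UniformWorkFloorTrap.WorkLipschitzCycles.stub_coeffCurveODE c N ω ν f hω hf hf0 hc0 hct hcs hcN hcr heq

-- One long assembly theorem (state space → orbit → truncations → solve → regularity → dictionary →
-- closeness): the cumulative elaboration cost is ≈ 1.5× the default budget although every step is
-- default-sized; splitting it would only move `W`-internal data through a 30-line interface.
set_option maxHeartbeats 400000 in
/-- **GALERKIN PERSISTENCE OF A NONDEGENERATE CYCLE AT FIXED VISCOSITY (L; provable now).**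
The Galerkin twin of `Literature.Analysis.FluidPDE.PeriodicNSOrbitPersists` (Henry 1981 Thm 8.3.2,
proved in tree as `PeriodicNSOrbitPersists_holds`): let `ν > 0`, `f` a mean-zero Galerkin-mode
force of order `m`, and `(u, p)` a classical `τ`-periodic (`τ > 0`) solution of `NS_ν(f)` on
`ℝ × T³` in the mean-zero leaf whose Floquet multiplier `1` is simple (clauses (i), (ii) as in
`stub_loudNondegenerateCycles`). Then for every `δ > 0` there is `N₀` such that for every Galerkin
order `N ≥ N₀` the Galerkin semiflow `Torus.galerkinFlow ν f N` has a periodic orbit — a Galerkin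
mode `a` of order `N` and a period `τ' > 0` with `galerkinFlow ν f N τ' a = a` — whose forward
orbit stays, uniformly in time and after the linear time rescaling matching the periods, within
`δ` of `u` in `L²` over one period: `∫ ‖galerkinFlow ν f N t a − u (τ t / τ')‖² ≤ δ` for
`t ∈ [0, τ']` (whence for all `t ≥ 0`, `sq_dist_le_of_periodic` below).
(Henry 1981 Thm 8.3.2; Brezzi–Rappaz–Raviart 1980 Part I, doi:10.1007/bf01395985, for the projection
approximation of a nonsingular solution of the bordered problem; Titi 1991, C. R. Acad. Sci. 312,
41–43. Proof route in
tree vocabulary: the space–time lattice of `PeriodicNSOrbitPersistsProofs` with the truncated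
bilinear map `P_N B(P_N ·, P_N ·)` on `W_N = P_N W`; consistency by rapid decay of the orbit's
lattice family, stability of the bordered linearisation by `P_N J = J P_N` and norm convergence
`P_N K P_N → K` of the compact linearised convection (`TimePeriodicNSLatticeCompact`); the lattice
solution realises a smooth periodic solution of the order-`N` Galerkin ODE, which is the
`galerkinFlow` orbit of its initial slice by uniqueness `IsGalerkinODESolution.eqOn`.) -/
theorem stub_galerkinCyclePersistence :
    ∀ (ν τ : ℝ) (m : ℕ) (f : 𝕋³ → E³) (u : ℝ → 𝕋³ → E³) (p : ℝ → 𝕋³ → ℝ),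
      0 < ν → 0 < τ → IsGalerkinMode m f → HasZeroMean f →
      Torus.IsClassicalNSSolutionOn Set.univ ν (fun _ => f) u p → Function.Periodic u τ →
      (∀ t, HasZeroMean (u t)) →
      (∀ (w : ℝ → 𝕋³ → ℂ³) (q : ℝ → 𝕋³ → ℂ),
          Torus.IsSmoothSpaceTimeOn Set.univ w → Torus.IsSmoothSpaceTimeOn Set.univ q →
          (∀ t, Torus.IsDivFreeC (w t)) → (∀ t, HasZeroMean (w t)) → Function.Periodic w τ →
          (∀ t x, Torus.timeDerivWithin Set.univ w t x =
            Torus.linearizedNSOperator ν (u t) (w t) (q t) x) →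
          ∃ z : ℂ, ∀ t x, w t x =
            z • Torus.realToComplex (Torus.timeDerivWithin Set.univ u t x)) →
      (∀ (w : ℝ → 𝕋³ → ℂ³) (q : ℝ → 𝕋³ → ℂ),
          Torus.IsSmoothSpaceTimeOn Set.univ w → Torus.IsSmoothSpaceTimeOn Set.univ q →
          (∀ t, Torus.IsDivFreeC (w t)) → (∀ t, HasZeroMean (w t)) → Function.Periodic w τ →
          ∃ t x, Torus.timeDerivWithin Set.univ w t x ≠
            Torus.linearizedNSOperator ν (u t) (w t) (q t) x +
              Torus.realToComplex (Torus.timeDerivWithin Set.univ u t x)) →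
      ∀ δ : ℝ, 0 < δ → ∃ N₀ : ℕ, ∀ N : ℕ, N₀ ≤ N →
        ∃ (a : 𝕋³ → E³) (τ' : ℝ), IsGalerkinMode N a ∧ 0 < τ' ∧
          Torus.galerkinFlow ν f N τ' a = a ∧
          ∀ t ∈ Set.Icc (0 : ℝ) τ',
            ∫ x, ‖Torus.galerkinFlow ν f N t a x - u (τ / τ' * t) x‖ ^ 2 ≤ δ := by
  intro ν τ m f u p hν hτ hfG hf0 hsol hper hmean hK hR δ hδ
  -- ### the state space `W` (verbatim `persists_main`)
  obtain ⟨W, hW, hWc⟩ := exists_space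
  haveI : CompleteSpace W := completeSpace_W hWc
  have hf : IsSmooth f := hfG.isSmooth
  have hfd : IsDivFree f := hfG.isDivFree
  -- ### the orbit
  have hU : IsSmooth (timeRoll τ u) := orbit_isSmooth hsol hper
  have hu0 : ∀ n : ℤ, 𝐨[τ, u] ((n, 0) : ℤ × (Fin 3 → ℤ)) = 0 := orbit_zero_modes hsol hper hf0
  have hut := orbit_transversal hsol hper
  have huc := orbit_conj hsol hper
  have hur := orbit_rapidDecay hsol hper
  have hmomx₀ : ∀ M : ℕ, ∑' mm : ℤ × (Fin 3 → ℤ), ENNReal.ofReal ((Λ mm) ^ M) * ‖(𝐬 (𝐨[τ, u])) mm‖ₑ ^ 2 ≠ ⊤ :=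
    fun M => moments_of_rapidDecay (C := mFourierCoeff (complexify ∘ fun y => timeRoll τ u y - ∫ x, u 0 x)) hur M
  have hx₀2 : ∑' mm : ℤ × (Fin 3 → ℤ), ‖(𝐬 (𝐨[τ, u])) mm‖ₑ ^ 2 ≠ ⊤ := by
    have := hmomx₀ 0; simpa only [pow_zero, ENNReal.ofReal_one, one_mul] using this
  obtain ⟨x₀, hx₀⟩ := exists_memW hW (v := 𝐬 (𝐨[τ, u])) hx₀2 (sw_zero_mode (x := 𝐨[τ, u]) hu0)
    (sw_transversal (x := 𝐨[τ, u]) hut) (sw_neg (x := 𝐨[τ, u]) huc)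
  have hcx₀ : 𝐜 (𝐰 x₀) = 𝐨[τ, u] := by rw [hx₀]; exact cw_sw (x := 𝐨[τ, u]) hu0
  -- ### the time-derivative direction `g = (2πi n) x₀`
  have hg2 : ∑' mm : ℤ × (Fin 3 → ℤ),
      ‖(fun mm : ℤ × (Fin 3 → ℤ) => (2 * Real.pi * Complex.I * (mm.1 : ℂ)) • (𝐬 (𝐨[τ, u])) mm) mm‖ₑ ^ 2 ≠ ⊤ := by
    have h1 := tsum_enorm_nsmul_sq_le (𝐬 (𝐨[τ, u])) 0
    simp only [pow_zero, ENNReal.ofReal_one, one_mul, zero_add] at h1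
    exact ne_top_of_le_ne_top (ENNReal.mul_ne_top ENNReal.ofReal_ne_top (hmomx₀ 2)) h1
  obtain ⟨g, hg⟩ := exists_memW hW
    (v := fun mm : ℤ × (Fin 3 → ℤ) => (2 * Real.pi * Complex.I * (mm.1 : ℂ)) • (𝐬 (𝐨[τ, u])) mm)
    hg2 (nsmul_zero_mode (x := 𝐬 (𝐨[τ, u])) (sw_zero_mode (x := 𝐨[τ, u]) hu0))
    (nsmul_transversal (x := 𝐬 (𝐨[τ, u])) (sw_transversal (x := 𝐨[τ, u]) hut))
    (nsmul_neg (x := 𝐬 (𝐨[τ, u])) (sw_neg (x := 𝐨[τ, u]) huc))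
  -- ### the multipliers and the isomorphism `J = τ⁻¹ Dₛ + L₀`
  obtain ⟨Ds, hDs, -⟩ := exists_diag hW (d := dS) (M := 2 * Real.pi) norm_dS_le dS_neg
  obtain ⟨L₀, hL₀, -⟩ := exists_diag hW (d := dL[ν, ∫ x, u 0 x]) norm_dL_le dL_neg
  obtain ⟨c₁, hc₁, hcl₁⟩ := exists_symbol_lower_bound (inv_pos.2 hτ) hν (∫ x, u 0 x)
  obtain ⟨J, hJ1, -, -, -⟩ := exists_diagEquiv hW
    (d := fun mm => ((τ⁻¹ : ℝ) : ℂ) * dS mm + dL[ν, ∫ x, u 0 x] mm)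
    (norm_omega_dS_add_dL_le τ⁻¹) (omega_dS_add_dL_neg τ⁻¹) hc₁ (le_norm_omega_dS_add_dL hcl₁)
  have hJ : ∀ h : W, J h = τ⁻¹ • Ds h + L₀ h := fun h => W_ext fun mm => by
    rw [hJ1, coeW_add, coeW_smul, Pi.add_apply, Pi.smul_apply, hDs, hL₀, ← Complex.coe_smul, smul_smul,
      ← add_smul]
  -- ### the bilinear map and the compact linearised convection
  obtain ⟨B, hBf, hBb⟩ := exists_bilinear hW
  obtain ⟨K, hK'⟩ : ∃ K : W →L[ℝ] W, ∀ w, K w = B x₀ w + B w x₀ :=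
    ⟨(hBb.deriv (x₀, x₀)).comp ((ContinuousLinearMap.id ℝ W).prod (ContinuousLinearMap.id ℝ W)), fun w => by
      simp [IsBoundedBilinearMap.deriv_apply]⟩
  have hx₀w : ∑' mm : ℤ × (Fin 3 → ℤ), ENNReal.ofReal ((1 + Λ mm) * sobolevWeight 1 mm.2) * ‖(𝐜 (𝐰 x₀)) mm‖ₑ ≠ ⊤ := by
    rw [hcx₀]; exact tsum_wt_weight_enorm_ne_top_of_rapidDecay hur
  have hKc : IsCompactOperator K := isCompactOperator_linearised hW hWc hBf x₀ hx₀w K hK'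
  -- ### hypotheses (i), (ii) as kernel and range conditions
  have hker : ∀ h : W, J h + K h = 0 → ∃ z : ℝ, h = z • g := fun h hh =>
    ker_condition hW hDs hL₀ hBf hν hτ hsol hper hf0 hK x₀ hx₀ g hg h (by rw [← hJ h, ← hK' h]; exact hh)
  have hrange : ∀ h : W, J h + K h ≠ Ds x₀ := fun h hh =>
    range_condition hW hDs hL₀ hBf hν hτ hsol hper hf0 hR x₀ hx₀ h (by rw [← hJ h, ← hK' h]; exact hh)
  -- ### NEW: the spatial truncations and the perturbed bordered solve
  obtain ⟨P, hP, hP1, hPs⟩ := stub_spatialTruncation hW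
  have hPK : Tendsto (fun n => ‖(P n).comp K - K‖) atTop (𝓝 0) := stub_compactTruncationNorm K hKc P hP1 hPs
  have hPB : Tendsto (fun n => P n (B x₀ x₀)) atTop (𝓝 (B x₀ x₀)) := hPs _
  -- the tolerance
  obtain ⟨ε, hε⟩ : ∃ ε : ℝ, ε = Real.sqrt (δ / (3 * (1 + 4 * Real.pi ^ 2))) := ⟨_, rfl⟩
  have hε0 : 0 < ε := by rw [hε]; exact Real.sqrt_pos.2 (by positivity)
  have hε2 : 3 * (1 + 4 * Real.pi ^ 2) * ε ^ 2 = δ := by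
    rw [hε, Real.sq_sqrt (by positivity)]; field_simp
  obtain ⟨δ₁, hδ₁⟩ : ∃ δ₁ : ℝ, δ₁ = min (τ⁻¹ / 2) ε := ⟨_, rfl⟩
  have hδ₁0 : 0 < δ₁ := by rw [hδ₁]; exact lt_min (by positivity) hε0
  obtain ⟨N₁, hN₁⟩ := stub_perturbedBorderedSolve Ds L₀ hBb x₀ τ⁻¹ J hJ K hK' hKc g hker hrange P hP1 hPK hPB hδ₁0
  -- ### the force family of the orbit
  have hyf2 : ∀ {F : UnitAddTorus (Fin 3) → EuclideanSpace ℝ (Fin 3)}, IsSmooth F →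
      ∑' mm : ℤ × (Fin 3 → ℤ), ‖(𝐲 F) mm‖ₑ ^ 2 ≠ ⊤ :=
    fun hF => by have := tsum_moment_yf_ne_top hF 0; simpa only [pow_zero, ENNReal.ofReal_one, one_mul] using this
  obtain ⟨Yf, hYf⟩ := exists_memW hW (v := 𝐲 f) (hyf2 hf) (yf_zero_mode f) (yf_transversal hf hfd) (yf_neg hf.continuous)
  have hy0 : τ⁻¹ • Ds x₀ + L₀ x₀ + B x₀ x₀ = Yf := by
    refine W_ext fun mm => ?_
    by_cases hm : mm.2 = 0
    · rw [W_zero' hW _ hm, W_zero' hW _ hm]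
    · rw [coord_G hDs hL₀ hBf x₀ τ⁻¹ mm, hYf, hcx₀, yf_of_snd_ne_zero f hm]
      exact orbit_equation hsol hper hτ hfd mm hm
  -- ### the threshold
  refine ⟨max N₁ m, fun N hN => ?_⟩
  have hN₁N : N₁ ≤ N := le_of_max_le_left hN
  have hmN : m ≤ N := le_of_max_le_right hN
  obtain ⟨x, om, hGx, hxx₀, homτ⟩ := hN₁ N hN₁N
  rw [hy0] at hGx
  have hom : 0 < om := by
    have h1 := (abs_lt.1 homτ).1
    have h2 : δ₁ ≤ τ⁻¹ / 2 := by rw [hδ₁]; exact min_le_left _ _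
    have h3 : 0 < τ⁻¹ := inv_pos.2 hτ
    linarith
  -- ### the lattice family `c = x/Λ` and its truncated equation
  have hc0 : ∀ n : ℤ, (𝐜 (𝐰 x)) (n, 0) = 0 := cw_zero_mode (W_zero hW x)
  have hct : ∀ mm : ℤ × (Fin 3 → ℤ), (∑ jj : Fin 3, ((mm.2 jj : ℤ) : ℂ) * ((𝐜 (𝐰 x)) mm) jj) = 0 :=
    cw_transversal (W_trans hW x)
  have hcs : ∀ mm : ℤ × (Fin 3 → ℤ), (𝐜 (𝐰 x)) (-mm) = conjVec ((𝐜 (𝐰 x)) mm) := cw_neg (W_conj hW x)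
  have hcoordP : ∀ mm : ℤ × (Fin 3 → ℤ), (𝐰 ((om • Ds x + L₀ x + P N (B x x) : W))) mm =
      σ[om, ν, ∫ x, u 0 x] mm • (𝐜 (𝐰 x)) mm +
        (if freqNormSq mm.2 ≤ (N : ℝ) ^ 2 then Torus.lerayCoeff mm.2 (𝐍[𝐜 (𝐰 x), 𝐜 (𝐰 x)] mm) else 0) := by
    intro mm
    rw [coeW_add, coeW_add, coeW_smul, Pi.add_apply, Pi.add_apply, Pi.smul_apply, hDs, hL₀, hP, hBf]
    congr 1
    rw [← Complex.coe_smul, smul_smul, ← add_smul, omega_dS_add_dL, ← smul_smul, ← Complex.ofReal_inv]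
  have hceq : ∀ mm : ℤ × (Fin 3 → ℤ), mm.2 ≠ 0 →
      σ[om, ν, ∫ x, u 0 x] mm • (𝐜 (𝐰 x)) mm +
        (if freqNormSq mm.2 ≤ (N : ℝ) ^ 2 then Torus.lerayCoeff mm.2 (𝐍[𝐜 (𝐰 x), 𝐜 (𝐰 x)] mm) else 0) =
        if mm.1 = 0 then mFourierCoeff (complexify ∘ f) mm.2 else 0 := by
    intro mm hm
    have h1 := congrArg (fun z : W => (𝐰 z) mm) hGx
    simp only at h1
    rw [hcoordP mm, hYf, yf_of_snd_ne_zero f hm] at h1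
    exact h1
  -- ### support in the ball `|k|² ≤ N²` (uses `N ≥ m`: the force has no modes there)
  obtain ⟨c₂, hc₂, hcl₂⟩ := exists_symbol_lower_bound hom hν (∫ x, u 0 x)
  have hsupp : ∀ mm : ℤ × (Fin 3 → ℤ), (N : ℝ) ^ 2 < freqNormSq mm.2 → (𝐜 (𝐰 x)) mm = 0 := by
    intro mm hmm
    have hm : mm.2 ≠ 0 := by
      intro h0; rw [h0, freqNormSq_zero] at hmm; exact absurd hmm (not_lt.2 (sq_nonneg _))
    have he := hceq mm hm
    rw [if_neg (not_le.2 hmm), add_zero] at he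
    have hfk : mFourierCoeff (complexify ∘ f) mm.2 = 0 := by
      refine hfG.mFourierCoeff_eq_zero (lt_of_le_of_lt ?_ hmm)
      exact_mod_cast Nat.pow_le_pow_left hmN 2
    have hrhs : (if mm.1 = 0 then mFourierCoeff (complexify ∘ f) mm.2 else 0) = 0 := by
      split_ifs <;> simp [hfk]
    rw [hrhs] at he
    have hσ : σ[om, ν, ∫ x, u 0 x] mm ≠ 0 := by
      intro h0
      have := hcl₂ mm hm
      beta_reduce at h0
      rw [h0, norm_zero] at this
      exact absurd this (not_le.2 (mul_pos hc₂ (wt_pos hm)))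
    exact (smul_eq_zero.1 he).resolve_left hσ
  -- ### parabolic regularity of `c`
  have hmomX₀ : ∀ M : ℕ, ∑' mm, ENNReal.ofReal ((Λ mm) ^ M) * ‖(𝐰 x₀) mm‖ₑ ^ 2 ≠ ⊤ := by
    intro M; rw [hx₀]; exact hmomx₀ M
  have hineq : ∀ mm : ℤ × (Fin 3 → ℤ), mm.2 ≠ 0 →
      c₂ * ‖(𝐰 x) mm‖ ≤ ‖(𝐲 f) mm‖ + ‖𝐍[𝐜 (𝐰 x), 𝐜 (𝐰 x)] mm‖ + ‖𝐍[𝐜 (𝐰 x₀), 𝐜 (𝐰 x)] mm‖ +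
        ‖𝐍[𝐜 (𝐰 x), 𝐜 (𝐰 x₀)] mm‖ := by
    intro mm hm
    have he := hceq mm hm
    have hL : (Λ mm) ≠ 0 := ne_of_gt (lt_of_lt_of_le one_pos (one_le_wt hm))
    have hxm : ‖(𝐰 x) mm‖ = Λ mm * ‖(𝐜 (𝐰 x)) mm‖ := by
      have e1 : ‖(𝐜 (𝐰 x)) mm‖ = (Λ mm)⁻¹ * ‖(𝐰 x) mm‖ := by
        change ‖((((Λ mm)⁻¹ : ℝ)) : ℂ) • (𝐰 x) mm‖ = _
        rw [norm_smul, Complex.norm_real, Real.norm_of_nonneg (inv_nonneg.2 (wt_nonneg mm))]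
      rw [e1, ← mul_assoc, mul_inv_cancel₀ hL, one_mul]
    have hσ := hcl₂ mm hm
    have htrunc : ‖(if freqNormSq mm.2 ≤ (N : ℝ) ^ 2 then Torus.lerayCoeff mm.2 (𝐍[𝐜 (𝐰 x), 𝐜 (𝐰 x)] mm) else 0)‖ ≤
        ‖𝐍[𝐜 (𝐰 x), 𝐜 (𝐰 x)] mm‖ := by
      split_ifs
      · exact SteadyLattice.norm_lerayCoeff_le _ _
      · rw [norm_zero]; exact norm_nonneg _
    have h1 : ‖σ[om, ν, ∫ x, u 0 x] mm • (𝐜 (𝐰 x)) mm‖ ≤ ‖(𝐲 f) mm‖ + ‖𝐍[𝐜 (𝐰 x), 𝐜 (𝐰 x)] mm‖ := by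
      rw [show σ[om, ν, ∫ x, u 0 x] mm • (𝐜 (𝐰 x)) mm = (𝐲 f) mm -
        (if freqNormSq mm.2 ≤ (N : ℝ) ^ 2 then Torus.lerayCoeff mm.2 (𝐍[𝐜 (𝐰 x), 𝐜 (𝐰 x)] mm) else 0) by
        rw [yf_of_snd_ne_zero f hm, ← he]; exact (add_sub_cancel_right _ _).symm]
      exact (norm_sub_le _ _).trans (add_le_add le_rfl htrunc)
    rw [norm_smul] at h1
    have h0 : 0 ≤ ‖𝐍[𝐜 (𝐰 x₀), 𝐜 (𝐰 x)] mm‖ := norm_nonneg _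
    have h0' : 0 ≤ ‖𝐍[𝐜 (𝐰 x), 𝐜 (𝐰 x₀)] mm‖ := norm_nonneg _
    calc c₂ * ‖(𝐰 x) mm‖ = (c₂ * Λ mm) * ‖(𝐜 (𝐰 x)) mm‖ := by rw [hxm]; ring
      _ ≤ ‖σ[om, ν, ∫ x, u 0 x] mm‖ * ‖(𝐜 (𝐰 x)) mm‖ := mul_le_mul_of_nonneg_right hσ (norm_nonneg _)
      _ ≤ _ := by linarith
  have hmomc := moments_of_lattice_ineq hc₂ (𝐰 x) (𝐰 x₀) (𝐲 f) (W_zero hW x) (W_zero hW x₀) (l2_tsum_enorm_sq_ne_top _)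
    hmomX₀ (tsum_moment_yf_ne_top hf) hineq
  have hcr : RapidDecay (𝐄 (𝐜 (𝐰 x))) := rapidDecay_of_moments (W_zero hW x) hmomc
  -- ### the drift-free truncated equation on the ball (mean-zero leaf)
  have hm0 : (∫ x, u 0 x) = 0 := hmean 0
  have heq' : ∀ mm : ℤ × (Fin 3 → ℤ), mm.2 ≠ 0 → freqNormSq mm.2 ≤ (N : ℝ) ^ 2 →
      (2 * Real.pi * Complex.I * (om : ℂ) * (mm.1 : ℂ) + ((4 * Real.pi ^ 2 * ν * freqNormSq mm.2 : ℝ) : ℂ)) •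
          (𝐜 (𝐰 x)) mm + Torus.lerayCoeff mm.2 (𝐍[𝐜 (𝐰 x), 𝐜 (𝐰 x)] mm) =
        if mm.1 = 0 then mFourierCoeff (complexify ∘ f) mm.2 else 0 := by
    intro mm hm hle
    have he := hceq mm hm
    rw [if_pos hle] at he
    rw [← he]
    congr 1
    simp only [hm0, PiLp.zero_apply, Complex.ofReal_zero, zero_mul, Finset.sum_const_zero, mul_zero, add_zero]
  have hfN : IsGalerkinMode N f :=
    ⟨hf, hfd, fun k hk => hfG.mFourierCoeff_eq_zero (lt_of_le_of_lt (by exact_mod_cast Nat.pow_le_pow_left hmN 2) hk)⟩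
  -- ### the dictionary stubs
  obtain ⟨hslice, hcoef⟩ := stub_synthSlices (𝐜 (𝐰 x)) N om hc0 hct hcs hsupp hcr
  obtain ⟨hcont, hderiv⟩ := stub_coeffCurveODE (𝐜 (𝐰 x)) N om ν f hom hfN hf0 hc0 hct hcs hsupp hcr heq'
  -- the realised field and its coefficient curve
  obtain ⟨u', hu'⟩ : ∃ u' : ℝ → 𝕋³ → E³, u' = fun t x' =>
      EuclideanSpace.realPart (fourierSynth (𝐄 (𝐜 (𝐰 x))) (Fin.cons (((om * t : ℝ)) : UnitAddCircle) x')) :=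
    ⟨_, rfl⟩
  obtain ⟨α, hαdef⟩ : ∃ α : ℝ → ↥(freqBall N : Finset (Fin 3 → ℤ)) → ℂ³,
      α = fun (t : ℝ) (k : ↥(freqBall N : Finset (Fin 3 → ℤ))) =>
        ∑' n : ℤ, (fourier n (((om * t : ℝ)) : UnitAddCircle) : ℂ) • (𝐜 (𝐰 x)) (n, (k : Fin 3 → ℤ)) :=
    ⟨_, rfl⟩
  have hcont' : Continuous α := by rw [hαdef]; exact hcont
  have hderiv' : ∀ t, HasDerivAt α (galerkinRHS (freqBall N) ν (fourierRestrict (freqBall N) f) (α t)) t := by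
    intro t; rw [hαdef]; exact hderiv t
  have hslice' : ∀ t, IsGalerkinMode N (u' t) := by
    intro t; rw [hu']; exact hslice t
  have hα : ∀ t, fourierRestrict (freqBall N) (u' t) = α t := by
    intro t; funext k
    rw [fourierRestrict_apply, hαdef, hu']
    exact hcoef t k
  have hODE : IsGalerkinODESolution ν (fourierRestrict (freqBall N) f) (α 0) α :=
    ⟨rfl, fun t => by rw [← hα t]; exact (hslice' t).fourierRestrict_mem, hcont'.continuousOn,
      fun T t _ => (hderiv' t).hasDerivWithinAt⟩
  have hflow : ∀ t, 0 ≤ t → Torus.galerkinFlow ν f N t (u' 0) = u' t := by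
    intro t ht
    rw [(hslice' 0).galerkinFlow_eq t, hα 0, hODE.galerkinCoeffFlow_eq ht, ← hα t]
    exact (hslice' t).realTrigPoly_fourierRestrict
  have hper' : Function.Periodic u' om⁻¹ := by
    rw [hu']
    exact periodic_comp_cons (fun y => EuclideanSpace.realPart (fourierSynth (𝐄 (𝐜 (𝐰 x))) y)) hom.ne'
  refine ⟨u' 0, om⁻¹, hslice' 0, inv_pos.2 hom, ?_, fun t ht => ?_⟩
  · rw [hflow _ (inv_pos.2 hom).le]
    have := hper' 0
    rwa [zero_add] at this
  · rw [hflow t ht.1]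
    -- ### the closeness estimate via the slice `H¹` bound
    obtain ⟨hV's, -, hVcoef⟩ := realSynth_spec' hcr (ext_neg_eq_conjVec (c := 𝐜 (𝐰 x)) hcs)
    obtain ⟨D, hDdef⟩ : ∃ D : UnitAddTorus (Fin 4) → EuclideanSpace ℝ (Fin 3),
        D = fun y => EuclideanSpace.realPart (fourierSynth (𝐄 (𝐜 (𝐰 x))) y) - (timeRoll τ u y - ∫ x, u 0 x) :=
      ⟨_, rfl⟩
    have hV : IsSmooth (fun y => timeRoll τ u y - ∫ x, u 0 x) := hU.sub (isSmooth_const _)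
    have hD : IsSmooth D := by rw [hDdef]; exact hV's.sub hV
    have he0 : ∀ n : ℤ, (𝐰 ((x - x₀ : W))) (n, 0) = 0 := W_zero hW _
    have he2 : ∑' mm, ‖(𝐰 ((x - x₀ : W))) mm‖ₑ ^ 2 ≠ ⊤ := l2_tsum_enorm_sq_ne_top _
    have he : ∀ mm : ℤ × (Fin 3 → ℤ), mFourierCoeff (complexify ∘ D) (Fin.cons mm.1 mm.2) = (𝐜 (𝐰 ((x - x₀ : W)))) mm := by
      intro mm
      have hsplit : (complexify ∘ D) =
          (complexify ∘ fun y => EuclideanSpace.realPart (fourierSynth (𝐄 (𝐜 (𝐰 x))) y)) -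
          (complexify ∘ fun y => timeRoll τ u y - ∫ x, u 0 x) := by
        rw [hDdef]; funext y; simp only [Function.comp_apply, Pi.sub_apply, map_sub]
      have hVc : IsSmooth (complexify ∘ fun y => timeRoll τ u y - ∫ x, u 0 x) :=
        hV.comp_clm complexify.toContinuousLinearMap
      have hRc : IsSmooth (complexify ∘ fun y => EuclideanSpace.realPart (fourierSynth (𝐄 (𝐜 (𝐰 x))) y)) :=
        hV's.comp_clm complexify.toContinuousLinearMap
      have h2 : mFourierCoeff (complexify ∘ fun y => EuclideanSpace.realPart (fourierSynth (𝐄 (𝐜 (𝐰 x))) y))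
          (Fin.cons mm.1 mm.2) = (𝐜 (𝐰 x)) mm := (hVcoef _).trans (ext_cons (𝐜 (𝐰 x)) mm)
      have e1 := congrArg (fun F : ℤ × (Fin 3 → ℤ) → EuclideanSpace ℂ (Fin 3) => F mm) hcx₀
      simp only at e1
      rw [hsplit, mFourierCoeff_sub hRc.integrable hVc.integrable, h2, ← e1, coeW_sub]
      beta_reduce
      rw [Pi.sub_apply, smul_sub]
    have hbound := slice_h1_le (D := D) hD (𝐰 ((x - x₀ : W))) he0 he he2 (((om * t : ℝ)) : UnitAddCircle)
    have hnorm : (∑' mm, ‖(𝐰 ((x - x₀ : W))) mm‖ₑ ^ 2).toReal = ‖x - x₀‖ ^ 2 := tsum_enorm_sq_toReal_eq _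
    rw [hnorm] at hbound
    have hfun : ∀ x' : UnitAddTorus (Fin 3), u' t x' - u (τ / om⁻¹ * t) x' =
        timeSlice D (((om * t : ℝ)) : UnitAddCircle) x' := by
      intro x'
      rw [timeSlice_apply, hDdef, hu']
      beta_reduce
      rw [timeRoll_cons hper (om * t) x', show τ / om⁻¹ * t = τ * (om * t) by rw [div_inv_eq_mul, mul_assoc], hm0,
        sub_zero]
    have hδ₁ε : δ₁ ≤ ε := by rw [hδ₁]; exact min_le_right _ _
    have hxx : ‖x - x₀‖ ^ 2 ≤ ε ^ 2 := by
      have := hxx₀.le.trans hδ₁ε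
      exact pow_le_pow_left₀ (norm_nonneg _) this 2
    have hgrad : 0 ≤ gradNormSq (timeSlice D (((om * t : ℝ)) : UnitAddCircle)) := gradNormSq_nonneg _
    calc (∫ x', ‖u' t x' - u (τ / om⁻¹ * t) x'‖ ^ 2)
        = ∫ x', ‖timeSlice D (((om * t : ℝ)) : UnitAddCircle) x'‖ ^ 2 := by
          have hint : (fun x' : UnitAddTorus (Fin 3) => ‖u' t x' - u (τ / om⁻¹ * t) x'‖ ^ 2) =
              fun x' => ‖timeSlice D (((om * t : ℝ)) : UnitAddCircle) x'‖ ^ 2 := funext fun x' => by rw [hfun x']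
          rw [hint]
      _ ≤ (∫ x', ‖timeSlice D (((om * t : ℝ)) : UnitAddCircle) x'‖ ^ 2) +
            gradNormSq (timeSlice D (((om * t : ℝ)) : UnitAddCircle)) := le_add_of_nonneg_right hgrad
      _ ≤ (3 * (1 + 4 * Real.pi ^ 2)) * ‖x - x₀‖ ^ 2 := hbound
      _ ≤ (3 * (1 + 4 * Real.pi ^ 2)) * ε ^ 2 := by gcongr
      _ = δ := hε2

/-! ## Proved glue -/

/-- **The block's margins are `L²`-robust** (the C⁰-closeness step of the card, proved): for smooth
fields `f, v, w` on `T³` with `kineticEnergy w ≤ E`, `(f, w) ≥ W₀` and `∫‖v − w‖² ≤ δ`, one has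
`kineticEnergy v ≤ 2E + δ` (from `‖v‖² ≤ 2‖w‖² + 2‖v − w‖²`) and
`(f, v) ≥ W₀ − (∫‖f‖²)^{1/2} δ^{1/2}` (Cauchy–Schwarz, `Literature.Analysis.FluidPDE.abs_integral_inner_le_sqrt_mul_sqrt`). -/
theorem margins_of_sq_dist_le {f v w : 𝕋³ → E³} {E W₀ δ : ℝ} (hf : IsSmooth f) (hv : IsSmooth v)
    (hw : IsSmooth w) (hE : kineticEnergy w ≤ E) (hW : W₀ ≤ ∫ x, ⟪f x, w x⟫_ℝ)
    (hδ : ∫ x, ‖v x - w x‖ ^ 2 ≤ δ) :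
    kineticEnergy v ≤ 2 * E + δ ∧
      W₀ - Real.sqrt (∫ x, ‖f x‖ ^ 2) * Real.sqrt δ ≤ ∫ x, ⟪f x, v x⟫_ℝ := by
  have hvw : IsSmooth (fun x => v x - w x) := hv.sub hw
  have hiv : Integrable (fun x => ‖v x‖ ^ 2) volume := hv.norm_sq.integrable
  have hiw : Integrable (fun x => ‖w x‖ ^ 2) volume := hw.norm_sq.integrable
  have hivw : Integrable (fun x => ‖v x - w x‖ ^ 2) volume := hvw.norm_sq.integrable
  have hδ0 : 0 ≤ δ := le_trans (integral_nonneg fun x => sq_nonneg _) hδ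
  constructor
  · -- energy: `∫‖v‖² ≤ 2∫‖w‖² + 2∫‖v - w‖² ≤ 4E + 2δ`
    have hpt : ∀ x, ‖v x‖ ^ 2 ≤ 2 * ‖w x‖ ^ 2 + 2 * ‖v x - w x‖ ^ 2 := by
      intro x
      have h1 : ‖v x‖ ≤ ‖w x‖ + ‖v x - w x‖ := by
        calc ‖v x‖ = ‖w x + (v x - w x)‖ := by congr 1; abel
          _ ≤ ‖w x‖ + ‖v x - w x‖ := norm_add_le _ _
      have h4 : 0 ≤ ‖v x‖ := norm_nonneg _
      have h5 : ‖v x‖ ^ 2 ≤ (‖w x‖ + ‖v x - w x‖) ^ 2 := pow_le_pow_left₀ h4 h1 2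
      nlinarith [sq_nonneg (‖w x‖ - ‖v x - w x‖)]
    have hint : ∫ x, ‖v x‖ ^ 2 ≤ ∫ x, (2 * ‖w x‖ ^ 2 + 2 * ‖v x - w x‖ ^ 2) :=
      integral_mono hiv ((hiw.const_mul 2).add (hivw.const_mul 2)) hpt
    have hsplit : ∫ x, (2 * ‖w x‖ ^ 2 + 2 * ‖v x - w x‖ ^ 2) =
        2 * (∫ x, ‖w x‖ ^ 2) + 2 * ∫ x, ‖v x - w x‖ ^ 2 := by
      rw [integral_add (hiw.const_mul 2) (hivw.const_mul 2), integral_const_mul, integral_const_mul]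
    have hKEw : 2⁻¹ * ∫ x, ‖w x‖ ^ 2 ≤ E := hE
    show 2⁻¹ * ∫ x, ‖v x‖ ^ 2 ≤ 2 * E + δ
    nlinarith [hint, hsplit, hKEw, hδ]
  · -- work: `∫⟪f, v⟫ = ∫⟪f, w⟫ + ∫⟪f, v - w⟫ ≥ W₀ - ‖f‖‖v - w‖`
    have hifw : Integrable (fun x => ⟪f x, w x⟫_ℝ) volume := (hf.inner hw).integrable
    have hifvw : Integrable (fun x => ⟪f x, v x - w x⟫_ℝ) volume := (hf.inner hvw).integrable
    have hsum : ∫ x, ⟪f x, v x⟫_ℝ = (∫ x, ⟪f x, w x⟫_ℝ) + ∫ x, ⟪f x, v x - w x⟫_ℝ := by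
      rw [← integral_add hifw hifvw]
      congr 1; funext x
      rw [← inner_add_right]; congr 1; abel
    have hcs := abs_integral_inner_le_sqrt_mul_sqrt (hf.memLp 2) (hvw.memLp 2)
    have hsq : Real.sqrt (∫ x, ‖v x - w x‖ ^ 2) ≤ Real.sqrt δ := Real.sqrt_le_sqrt hδ
    have hf0 : 0 ≤ Real.sqrt (∫ x, ‖f x‖ ^ 2) := Real.sqrt_nonneg _
    have hlow : -(Real.sqrt (∫ x, ‖f x‖ ^ 2) * Real.sqrt δ) ≤ ∫ x, ⟪f x, v x - w x⟫_ℝ := by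
      have := (abs_le.1 hcs).1
      nlinarith [mul_le_mul_of_nonneg_left hsq hf0]
    linarith

/-- **A periodic point of the Galerkin semiflow returns at every multiple of its period**
(`galerkinFlow_add`, induction). -/
theorem galerkinFlow_nat_mul_period {ν : ℝ} {N : ℕ} {f a : 𝕋³ → E³} {τ' : ℝ}
    (ha : IsGalerkinMode N a) (hν : 0 ≤ ν) (hf : Integrable f volume) (hτ' : 0 ≤ τ')
    (hper : Torus.galerkinFlow ν f N τ' a = a) (k : ℕ) :
    Torus.galerkinFlow ν f N (k * τ') a = a := by
  induction k with
  | zero => simp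
  | succ k ih =>
    have hk : (0 : ℝ) ≤ k * τ' := mul_nonneg (Nat.cast_nonneg k) hτ'
    rw [Nat.cast_succ, add_mul, one_mul, ha.galerkinFlow_add hν hf hk hτ', hper, ih]

/-- **Closeness over one period is closeness forever.** If the `galerkinFlow` orbit of the
`τ'`-periodic point `a` is `δ`-close in `L²` to the rescaled `τ`-periodic `u` on `[0, τ']`, it is so
for all `t ≥ 0` (write `t = s + k τ'`, `s ∈ [0, τ']`; semigroup law + `galerkinFlow_nat_mul_period`
on the Galerkin side, `Function.Periodic.nat_mul` on the PDE side). -/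
theorem sq_dist_le_of_periodic {ν τ τ' δ : ℝ} {N : ℕ} {f a : 𝕋³ → E³} {u : ℝ → 𝕋³ → E³}
    (ha : IsGalerkinMode N a) (hν : 0 ≤ ν) (hf : Integrable f volume) (hτ' : 0 < τ')
    (hu : Function.Periodic u τ) (hper : Torus.galerkinFlow ν f N τ' a = a)
    (hclose : ∀ t ∈ Set.Icc (0 : ℝ) τ',
      ∫ x, ‖Torus.galerkinFlow ν f N t a x - u (τ / τ' * t) x‖ ^ 2 ≤ δ) :
    ∀ t : ℝ, 0 ≤ t → ∫ x, ‖Torus.galerkinFlow ν f N t a x - u (τ / τ' * t) x‖ ^ 2 ≤ δ := by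
  intro t ht
  -- the last return time `k τ' ≤ t < (k + 1) τ'`
  set k : ℕ := ⌊t / τ'⌋₊ with hk
  have hk1 : (k : ℝ) ≤ t / τ' := Nat.floor_le (div_nonneg ht hτ'.le)
  have hk2 : t / τ' < k + 1 := Nat.lt_floor_add_one (t / τ')
  have hkT : (k : ℝ) * τ' ≤ t := by
    have := mul_le_mul_of_nonneg_right hk1 hτ'.le
    rwa [div_mul_cancel₀ t hτ'.ne'] at this
  have htT : t < (k + 1) * τ' := by
    have := mul_lt_mul_of_pos_right hk2 hτ'
    rwa [div_mul_cancel₀ t hτ'.ne'] at this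
  set s : ℝ := t - k * τ' with hs
  have hs0 : 0 ≤ s := by rw [hs]; linarith
  have hs1 : s ≤ τ' := by rw [hs]; nlinarith
  have hkτ : (0 : ℝ) ≤ k * τ' := mul_nonneg (Nat.cast_nonneg k) hτ'.le
  have ht_eq : t = s + k * τ' := by rw [hs]; ring
  have hflow : Torus.galerkinFlow ν f N t a = Torus.galerkinFlow ν f N s a := by
    rw [ht_eq, ha.galerkinFlow_add hν hf hs0 hkτ, galerkinFlow_nat_mul_period ha hν hf hτ'.le hper k]
  have hu_eq : u (τ / τ' * t) = u (τ / τ' * s) := by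
    have harith : τ / τ' * t = τ / τ' * s + k * τ := by
      rw [ht_eq]; field_simp
    rw [harith]
    exact hu.nat_mul k (τ / τ' * s)
  rw [hflow, hu_eq]
  exact hclose s ⟨hs0, hs1⟩

/-! ## The composition -/

/-- **The line closes the crux modulo its stubs.** From `stub_loudNondegenerateCycles` take
`(m, f, E, ε₁, ν₀)`; at `0 < ν ≤ ν₀` take the nondegenerate loud bounded cycle `(τ, u, p)`; with
`δ = ε₁² / (∫‖f‖² + 1)` the persistence stub gives `N₀(ν)` and, for `N ≥ N₀`, a Galerkin mode `a` whose
`galerkinFlow` orbit is `δ`-close in `L²` to the (time-rescaled) cycle for all `t ≥ 0`; by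
`margins_of_sq_dist_le` the orbit stays in `{kineticEnergy ≤ 2E + δ} ∩ {(f, ·) ≥ ε₁}` — hence in the
block with the ν-free constants `E' = 2E + ε₁² `, `ε₀ = ε₁` — and `uniformWorkFloorTrap_iff_orbit`
(p107806) turns the trapped orbit into the crux's trajectory clauses. -/
theorem UniformWorkFloorTrap_of : UniformWorkFloorTrap := by
  obtain ⟨m, f, hf, hf0, E, ε₁, ν₀, hε₁, hν₀, H⟩ := stub_loudNondegenerateCycles
  rw [uniformWorkFloorTrap_iff_orbit]
  -- the `L²` tolerance, chosen once for all `ν`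
  set F : ℝ := ∫ x, ‖f x‖ ^ 2 with hFdef
  have hF0 : 0 ≤ F := integral_nonneg fun x => sq_nonneg _
  set δ : ℝ := ε₁ ^ 2 / (F + 1) with hδdef
  have hδ0 : 0 < δ := div_pos (pow_pos hε₁ 2) (by linarith)
  have hδ1 : δ ≤ ε₁ ^ 2 := by
    rw [hδdef, div_le_iff₀ (by linarith : (0 : ℝ) < F + 1)]
    nlinarith [pow_pos hε₁ 2]
  have hδF : Real.sqrt F * Real.sqrt δ ≤ ε₁ := by
    rw [← Real.sqrt_mul hF0]
    calc Real.sqrt (F * δ) ≤ Real.sqrt (ε₁ ^ 2) := by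
            apply Real.sqrt_le_sqrt
            rw [hδdef, mul_div_assoc']
            rw [div_le_iff₀ (by linarith : (0 : ℝ) < F + 1)]
            nlinarith [pow_pos hε₁ 2]
      _ = ε₁ := Real.sqrt_sq hε₁.le
  refine ⟨m, f, hf, hf0, 2 * E + δ, ε₁, ν₀, hε₁, hν₀, fun ν hν hνν₀ => ?_⟩
  obtain ⟨τ, u, p, hτ, hsol, hper, hmean, hker, hran, hB⟩ := H ν hν hνν₀
  obtain ⟨N₀, hN₀⟩ := stub_galerkinCyclePersistence ν τ m f u p hν hτ hf hf0 hsol hper hmean hker hran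
    δ hδ0
  refine ⟨N₀, fun N hN => ?_⟩
  obtain ⟨a, τ', ha, hτ', hreturn, hclose1⟩ := hN₀ N hN
  have hclose := sq_dist_le_of_periodic ha hν.le hf.isSmooth.integrable hτ' hper hreturn hclose1
  refine ⟨a, ha, fun t ht => ?_⟩
  -- smoothness of the two slices being compared
  have hslice_u : IsSmooth (u (τ / τ' * t)) :=
    hsol.smooth_velocity.isSmooth_slice (Set.mem_univ _)
  have hslice_a : IsSmooth (Torus.galerkinFlow ν f N t a) := (ha.isGalerkinMode_galerkinFlow t).isSmooth
  obtain ⟨hEu, hWu⟩ := hB (τ / τ' * t)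
  obtain ⟨hKE, hW⟩ := margins_of_sq_dist_le hf.isSmooth hslice_a hslice_u hEu hWu (hclose t ht)
  refine ⟨hKE, ?_⟩
  have : 2 * ε₁ - Real.sqrt F * Real.sqrt δ ≤ ∫ x, ⟪f x, Torus.galerkinFlow ν f N t a x⟫_ℝ := hW
  linarith

end Summit.AnomalousDissipation.AnomalousDissipation.Cruxes.UniformWorkFloorTrap.WorkLipschitzCycles

end
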